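/-
Copyright (c) 2026 the pub-hodgecm-mathlib formalisation cell (harness21).  Prover seat hodgecm-mathlib-K2E1-p09 (g4), Track B ∕ K2-LIT,
h413 = `stmt-HodgeConjecture-24833`, line `K2_E1_TraceFormulaBeta`, campaign RES-RANK-ONE, page «EIS-RANK-ONE», SPEC «EIS-R6»: the dischargers of the invariance binders
`hfN ∕ hMfN ∕ hMf` of R6b (★ p857445) and R6c (★ p857469); self-dealt (β) 2026-09-04T04:59Z, REPORT-FIRST 05:08Z.
-/
import Summits.HodgeConjecture.HodgeConjecture.Theorems.K2E1BorelCosetsDictionary     -- ★ p857409 (this seat) + ★ p857274 §1 (`toAdelic_mem_borelAdelic_iff`, `toAdelic_mem_adelicUnipotent_iff`, `toAdelic_mul_quasiSplit`)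
import Literature.NumberTheory.Automorphic.UnitaryGroupUnipotentHaarTorusConj          -- ★ `map_borelConj_eq_torusRootModulus_smul` (N = 3), ★ `isMulRightInvariant_of_isHaarMeasure_adelicUnipotent_three`
import Literature.NumberTheory.Automorphic.UnitaryGroupKernelBorelClassHomogeneityTwo  -- ★ `map_borelConj_eq_torusRootModulus_smul_two`
import Literature.NumberTheory.Automorphic.UnitaryGroupLineUnipotentTwo                -- ★ `isMulRightInvariant_of_isMulLeftInvariant_two`
import Literature.NumberTheory.Automorphic.UnitaryGroupBorelThinSetIntegralEq          -- ★ product formula `torusRootModulus_diagUnit_eq_one_of_mem_arithmeticSubgroup`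
import Literature.NumberTheory.Automorphic.CMBorelWeylTorusConjugate                   -- ★ `weylConj_mem_borelU` (N = 3), `borelTriple`
import Literature.NumberTheory.Automorphic.CMBorelWeylTorusConjugateTwo                -- ★ `weylConj_mem_two`
import HarnessLib

/-!
# h413 ∕ Track B «K2-LIT», page EIS-RANK-ONE — `K2E1IntertwinedSectionInvariance`: the intertwined section `M f (g) = (ν 𝓕)⁻¹ ∫_{N(𝔸)} f(ι(J_N) v g) dν(v)` is LEFT-`N(𝔸_F)`-
# and LEFT-`B(F)`-INVARIANT (the `hMfN`, `hMf` binders of R6b∕R6c discharged for Mok's `U(J₃)`, `U(J₂)`)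

Cell `pub/hodgecm-mathlib`, crux H413 = `stmt-HodgeConjecture-24833`, route `HCCMUnconditional`; dealer K2E1-plan (g3).  THEOREMS ONLY (no `def`, no `instance`, no `notation`, no
named-fact hypothesis, no `sorry`); lane `--kind proof --supports stmt-HodgeConjecture-24833 --as helper` (count-neutral).

* §1 GENERIC ENGINE (any topological group `G`, `N ≤ G`, a measure `ν` on `↥N`, `w : G`, LEFT convention `∫ f(w v g) dν(v)`): right translation of the variable (`u ∈ N`, `ν`
  right-invariant) and CONJUGATION of the variable by `t` (`t⁻¹ N t ⊆ N`, `(v ↦ t⁻¹ v t)_* ν = ν`, `f` left-invariant under `w t w⁻¹`).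
* §2 MOK's `U(J₃)` (`c² = 1`, `c ≠ 1`, `ν` a Haar measure on `N(𝔸_F)`): `∫ f(ι(J₃) v (u g)) dν = ∫ f(ι(J₃) v g) dν` for `u ∈ N(𝔸_F)` (★ unimodularity of `N(𝔸_F)`), and for every
  RATIONAL Borel `b₀ ∈ B(F)` and left-`B(F)`-invariant Borel-measurable `f`: **`∫ f(ι(J₃) v (ι b₀ g)) dν = ∫ f(ι(J₃) v g) dν`** — `b₀ = t₀ n₀` (Levi projection ★ `borelTriple.proj`),
  `n₀` by §1, `t₀` by §1 with `(v ↦ ι t₀⁻¹ v ι t₀)_* ν = δ_B(ι t₀) ν` (★ `map_borelConj_eq_torusRootModulus_smul`) and the PRODUCT FORMULA `δ_B = 1` on `B(F)` (★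
  `torusRootModulus_diagUnit_eq_one_of_mem_arithmeticSubgroup`), `ι(J₃) t₀ ι(J₃)⁻¹ ∈ B(F)` (★ `weylConj_mem_borelU`); then the `(ν 𝓕)⁻¹ •` corollaries in the exact shape of the
  `hMfN`, `hMf` binders (Track-A spelling through ★ p857409 `forall_arithmeticBorel_iff`).
* §3 the `U(J₂)` twins.

HONEST LABEL.  Count-neutral helper; proves no printed statement; HC_CM is proved only modulo the 7 printed citations (2 remaining named inputs: hLiu418 =
`stmt-HodgeConjecture-24832`, h413 = `stmt-HodgeConjecture-24833`) until rung 0 closes.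

## References
* [MoeglinWaldspurger1995] C. Mœglin, J.-L. Waldspurger, *Spectral decomposition and Eisenstein series* (1995), I.2.6, II.1.6–II.1.7 (`M(w, π)` maps sections to sections).
* [Garrett2018] P. Garrett, *Modern Analysis of Automorphic Forms by Example* 1 (2018), §2.8 (the constant term `c_P E = φ + c(s) φ^w` is again left `P_k N_𝔸`-invariant).
* [Rogawski1990] J. D. Rogawski, *Automorphic Representations of Unitary Groups in Three Variables* (1990), §1.10, §2.2.
-/

set_option autoImplicit false
set_option linter.dupNamespace false  -- the mandated namespace repeats the summit's segment (`HodgeConjecture.HodgeConjecture`)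

noncomputable section
open MeasureTheory Measure NumberField IsDedekindDomain Matrix MulAction
open Literature.NumberTheory.Automorphic Literature.NumberTheory.Automorphic.UnitaryGroup AdelicGroupData
open Summit.HodgeConjecture.HodgeConjecture.Cruxes.H413.K2E1PseudoEisensteinConstantTermU
open Summit.HodgeConjecture.HodgeConjecture.Cruxes.H413.K2E1BorelCosetsDictionary
open scoped MatrixGroups NNReal ENNReal

namespace Summit.HodgeConjecture.HodgeConjecture.Cruxes.H413.K2E1IntertwinedSectionInvariance

/-! ## §1 Generic engine: right translation and conjugation of the integration variable -/

section Engine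

variable {G : Type*} [Group G] [TopologicalSpace G] [IsTopologicalGroup G] [MeasurableSpace G] [BorelSpace G] (N : Subgroup G) (ν : Measure N)

/-- **`∫ f(w v (u g)) dν(v) = ∫ f(w v g) dν(v)` for `u ∈ N`** when `ν` is right-invariant (`v u` for `v`; Mathlib `integral_mul_right_eq_self`). [cite: MoeglinWaldspurger1995, II.1.6] -/
theorem integral_weyl_mul_unipotent_mul [ν.IsMulRightInvariant] (f : G → ℂ) (w : G) (u : N) (g : G) :
    ∫ v : N, f (w * (v : G) * ((u : G) * g)) ∂ν = ∫ v : N, f (w * (v : G) * g) ∂ν := by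
  have h : (fun v : N => f (w * (v : G) * ((u : G) * g))) = fun v : N => (fun v' : N => f (w * (v' : G) * g)) (v * u) := by
    funext v; simp only [Subgroup.coe_mul, mul_assoc]
  rw [h]
  exact integral_mul_right_eq_self (fun v' : N => f (w * (v' : G) * g)) u

/-- **`∫ f(w v (t g)) dν(v) = ∫ f(w v g) dν(v)`** when conjugation by `t` preserves `N` and `ν` (`(v ↦ t⁻¹ v t)_* ν = ν`) and `f` is left-invariant under `w t w⁻¹`:
`w v t g = (w t w⁻¹) · w (t⁻¹ v t) g` and the change of variables `v ↦ t⁻¹ v t` (Mathlib `integral_map`). [cite: MoeglinWaldspurger1995, II.1.6] [cite: Garrett2018, §2.8] -/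
theorem integral_weyl_mul_conj_mul {f : G → ℂ} (hfm : Measurable f) (w : G) {t : G} (htN : ∀ v : N, t⁻¹ * (v : G) * t ∈ N)
    (hmod : ν.map (fun v : N => (⟨t⁻¹ * (v : G) * t, htN v⟩ : N)) = ν) (hft : ∀ y : G, f (w * t * w⁻¹ * y) = f y) (g : G) :
    ∫ v : N, f (w * (v : G) * (t * g)) ∂ν = ∫ v : N, f (w * (v : G) * g) ∂ν := by
  have hκ : Measurable fun v : N => (⟨t⁻¹ * (v : G) * t, htN v⟩ : N) := ((measurable_subtype_coe.const_mul t⁻¹).mul_const t).subtype_mk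
  have hF : Measurable fun u : N => f (w * (u : G) * g) := hfm.comp ((measurable_subtype_coe.const_mul w).mul_const g)
  have h1 : (fun v : N => f (w * (v : G) * (t * g))) = fun v : N => (fun u : N => f (w * (u : G) * g)) (⟨t⁻¹ * (v : G) * t, htN v⟩ : N) := by
    funext v
    change f (w * (v : G) * (t * g)) = f (w * (t⁻¹ * (v : G) * t) * g)
    rw [← hft (w * (t⁻¹ * (v : G) * t) * g)]
    congr 1; group
  rw [h1, ← integral_map hκ.aemeasurable hF.aestronglyMeasurable, hmod]

end Engine

/-! ## §2 Mok's `U(J₃)`: `M f` is left-`N(𝔸_F)`- and left-`B(F)`-invariant -/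

section Three

variable {F E : Type} [Field F] [NumberField F] [Field E] [NumberField E] [Algebra F E] {c : E ≃ₐ[F] E}
  [MeasurableSpace (quasiSplit F E c 3).Adelic] [BorelSpace (quasiSplit F E c 3).Adelic]

/-- **`∫ f(ι(J₃) v (u g)) dν = ∫ f(ι(J₃) v g) dν` for `u ∈ N(𝔸_F)`**, `ν` a Haar measure on `N(𝔸_F)` of `U(J₃)` (right-invariant: `N(𝔸_F)` is unimodular, ★
`isMulRightInvariant_of_isHaarMeasure_adelicUnipotent_three`). [cite: MoeglinWaldspurger1995, II.1.6] -/
theorem integral_weyl_mul_unipotent_mul_three (hc : c * c = 1) (ν : Measure ↥(adelicUnipotent F E c 3)) [ν.IsHaarMeasure] (f : (quasiSplit F E c 3).Adelic → ℂ)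
    {u : (quasiSplit F E c 3).Adelic} (hu : u ∈ adelicUnipotent F E c 3) (g : (quasiSplit F E c 3).Adelic) :
    ∫ v : ↥(adelicUnipotent F E c 3), f ((quasiSplit F E c 3).toAdelic (weylLongU (c : E →+* E) (rfl : (StdForm.antidiagonal 3).over E = (StdForm.antidiagonal 3).over E)) *
        (v : (quasiSplit F E c 3).Adelic) * (u * g)) ∂ν =
      ∫ v : ↥(adelicUnipotent F E c 3), f ((quasiSplit F E c 3).toAdelic (weylLongU (c : E →+* E) (rfl : (StdForm.antidiagonal 3).over E = (StdForm.antidiagonal 3).over E)) *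
        (v : (quasiSplit F E c 3).Adelic) * g) ∂ν := by
  haveI := isMulRightInvariant_of_isHaarMeasure_adelicUnipotent_three hc ν
  exact integral_weyl_mul_unipotent_mul (adelicUnipotent F E c 3) ν f _ ⟨u, hu⟩ g

/-- **CONJUGATION BY A RATIONAL TORUS ELEMENT PRESERVES THE HAAR MEASURE OF `N(𝔸_F)`** (`U(J₃)`): for `t₀ ∈ T(F)`, `(v ↦ ι t₀⁻¹ v ι t₀)_* ν = ν` — ★ `map_borelConj_eq_torusRootModulus_smul`
(`= δ_B(ι t₀) • ν`) and the product formula ★ `torusRootModulus_diagUnit_eq_one_of_mem_arithmeticSubgroup` (`δ_B = 1` on `B(F)`). [cite: MoeglinWaldspurger1995, I.2.6] [cite: Rogawski1990, §2.2] -/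
theorem map_conj_toAdelic_eq_self_three (hc : c * c = 1) (hc1 : c ≠ 1) (ν : Measure ↥(adelicUnipotent F E c 3)) [ν.IsHaarMeasure]
    {b₀ : ↥(unitaryGroupOfForm (c : E →+* E) ((StdForm.antidiagonal 3).over E))} (hb₀ : b₀ ∈ borelU (c : E →+* E) ((StdForm.antidiagonal 3).over E)) :
    ν.map (fun v : ↥(adelicUnipotent F E c 3) => (⟨((quasiSplit F E c 3).toAdelic b₀)⁻¹ * (v : (quasiSplit F E c 3).Adelic) * (quasiSplit F E c 3).toAdelic b₀,
      conj_mem_adelicUnipotent ((K2E1PseudoEisensteinConstantTermU.toAdelic_mem_borelAdelic_iff b₀).2 hb₀) v.2⟩ : ↥(adelicUnipotent F E c 3))) = ν := by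
  have hB : (quasiSplit F E c 3).toAdelic b₀ ∈ borelAdelic F E c 3 := (K2E1PseudoEisensteinConstantTermU.toAdelic_mem_borelAdelic_iff b₀).2 hb₀
  have h := map_borelConj_eq_torusRootModulus_smul hc hc1 ν ⟨(quasiSplit F E c 3).toAdelic b₀, hB⟩
  have h1 : torusRootModulus E 3 (diagUnit (⟨(quasiSplit F E c 3).toAdelic b₀, hB⟩ : borelAdelic F E c 3).2) = 1 :=
    torusRootModulus_diagUnit_eq_one_of_mem_arithmeticSubgroup _ ⟨b₀, rfl⟩
  rw [h1, ENNReal.coe_one, one_smul] at h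
  exact h

/-- **`∫ f(ι(J₃) v (ι b₀ g)) dν = ∫ f(ι(J₃) v g) dν` FOR EVERY RATIONAL BOREL `b₀ ∈ B(F)`** (`f` Borel-measurable and left-`B(F)`-invariant, `ν` Haar): the LEFT-`B(F)`-INVARIANCE of the
intertwined section `M f`.  `b₀ = t₀ n₀` (★ Levi projection of `borelTriple`), `n₀` by right translation, `t₀` by conjugation (modulus `1`) and `ι(J₃) t₀ ι(J₃)⁻¹ ∈ B(F)`.
[cite: MoeglinWaldspurger1995, II.1.7] [cite: Garrett2018, §2.8] -/
theorem integral_weyl_mul_toAdelic_borelU_mul_three (hc : c * c = 1) (hc1 : c ≠ 1) (ν : Measure ↥(adelicUnipotent F E c 3)) [ν.IsHaarMeasure]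
    {f : (quasiSplit F E c 3).Adelic → ℂ} (hfm : Measurable f)
    (hf : ∀ b ∈ borelU (c : E →+* E) ((StdForm.antidiagonal 3).over E), ∀ x : (quasiSplit F E c 3).Adelic, f ((quasiSplit F E c 3).toAdelic b * x) = f x)
    {b₀ : ↥(unitaryGroupOfForm (c : E →+* E) ((StdForm.antidiagonal 3).over E))} (hb₀ : b₀ ∈ borelU (c : E →+* E) ((StdForm.antidiagonal 3).over E))
    (g : (quasiSplit F E c 3).Adelic) :
    ∫ v : ↥(adelicUnipotent F E c 3), f ((quasiSplit F E c 3).toAdelic (weylLongU (c : E →+* E) (rfl : (StdForm.antidiagonal 3).over E = (StdForm.antidiagonal 3).over E)) *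
        (v : (quasiSplit F E c 3).Adelic) * ((quasiSplit F E c 3).toAdelic b₀ * g)) ∂ν =
      ∫ v : ↥(adelicUnipotent F E c 3), f ((quasiSplit F E c 3).toAdelic (weylLongU (c : E →+* E) (rfl : (StdForm.antidiagonal 3).over E = (StdForm.antidiagonal 3).over E)) *
        (v : (quasiSplit F E c 3).Adelic) * g) ∂ν := by
  -- the Levi decomposition `b₀ = t₀ n₀`
  set t₀ : ↥(torusU (c : E →+* E) ((StdForm.antidiagonal 3).over E)) :=
    (borelTriple (c : E →+* E) ((StdForm.antidiagonal 3).over E) rfl).proj ⟨b₀, hb₀⟩ with ht₀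
  have hn₀ : (t₀ : ↥(unitaryGroupOfForm (c : E →+* E) ((StdForm.antidiagonal 3).over E)))⁻¹ * b₀ ∈ unipotentU (c : E →+* E) ((StdForm.antidiagonal 3).over E) :=
    (borelTriple (c : E →+* E) ((StdForm.antidiagonal 3).over E) rfl).proj_inv_mul_mem ⟨b₀, hb₀⟩
  have ht₀B : (t₀ : ↥(unitaryGroupOfForm (c : E →+* E) ((StdForm.antidiagonal 3).over E))) ∈ borelU (c : E →+* E) ((StdForm.antidiagonal 3).over E) :=
    torusU_le_borelU _ _ t₀.2
  have hdec : (quasiSplit F E c 3).toAdelic b₀ = (quasiSplit F E c 3).toAdelic (t₀ : ↥(unitaryGroupOfForm (c : E →+* E) ((StdForm.antidiagonal 3).over E))) *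
      (quasiSplit F E c 3).toAdelic ((t₀ : ↥(unitaryGroupOfForm (c : E →+* E) ((StdForm.antidiagonal 3).over E)))⁻¹ * b₀) := by
    rw [← toAdelic_mul_quasiSplit, mul_inv_cancel_left]
  have hn₀A : (quasiSplit F E c 3).toAdelic ((t₀ : ↥(unitaryGroupOfForm (c : E →+* E) ((StdForm.antidiagonal 3).over E)))⁻¹ * b₀) ∈ adelicUnipotent F E c 3 :=
    (toAdelic_mem_adelicUnipotent_iff _).2 hn₀
  -- `ι(J₃) t₀ ι(J₃)⁻¹ ∈ B(F)`
  have hwt : ∀ y : (quasiSplit F E c 3).Adelic,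
      f ((quasiSplit F E c 3).toAdelic (weylLongU (c : E →+* E) (rfl : (StdForm.antidiagonal 3).over E = (StdForm.antidiagonal 3).over E)) *
        (quasiSplit F E c 3).toAdelic (t₀ : ↥(unitaryGroupOfForm (c : E →+* E) ((StdForm.antidiagonal 3).over E))) *
        ((quasiSplit F E c 3).toAdelic (weylLongU (c : E →+* E) (rfl : (StdForm.antidiagonal 3).over E = (StdForm.antidiagonal 3).over E)))⁻¹ * y) = f y := fun y => by
    rw [← map_inv, ← toAdelic_mul_quasiSplit, ← toAdelic_mul_quasiSplit]
    exact hf _ (weylConj_mem_borelU (c : E →+* E) rfl (weylLongU (c : E →+* E) rfl) (coe_coe_weylLongU (c : E →+* E) rfl) t₀) y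
  rw [hdec, mul_assoc ((quasiSplit F E c 3).toAdelic (t₀ : ↥(unitaryGroupOfForm (c : E →+* E) ((StdForm.antidiagonal 3).over E)))),
    integral_weyl_mul_conj_mul (adelicUnipotent F E c 3) ν hfm _ (fun v => conj_mem_adelicUnipotent ((K2E1PseudoEisensteinConstantTermU.toAdelic_mem_borelAdelic_iff _).2 ht₀B) v.2)
      (map_conj_toAdelic_eq_self_three hc hc1 ν ht₀B) hwt,
    integral_weyl_mul_unipotent_mul_three hc ν f hn₀A g]

/-- **THE `hMfN` BINDER OF R6b∕R6c DISCHARGED ON `U(J₃)`**: `M f (u x) = M f (x)` for `u ∈ N(𝔸_F)`, `M f (g) = (ν 𝓕).toReal⁻¹ • ∫ f(ι(J₃) v g) dν(v)`. [cite: MoeglinWaldspurger1995, II.1.7] -/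
theorem intertwinedSection_unipotent_mul_three (hc : c * c = 1) (ν : Measure ↥(adelicUnipotent F E c 3)) [ν.IsHaarMeasure] (𝓕 : Set ↥(adelicUnipotent F E c 3))
    (f : (quasiSplit F E c 3).Adelic → ℂ) :
    ∀ u ∈ adelicUnipotent F E c 3, ∀ x : (quasiSplit F E c 3).Adelic,
      (fun g : (quasiSplit F E c 3).Adelic => ((ν 𝓕).toReal⁻¹ : ℝ) • ∫ v : ↥(adelicUnipotent F E c 3),
        f ((quasiSplit F E c 3).toAdelic (weylLongU (c : E →+* E) (rfl : (StdForm.antidiagonal 3).over E = (StdForm.antidiagonal 3).over E)) *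
          (v : (quasiSplit F E c 3).Adelic) * g) ∂ν) (u * x) =
      (fun g : (quasiSplit F E c 3).Adelic => ((ν 𝓕).toReal⁻¹ : ℝ) • ∫ v : ↥(adelicUnipotent F E c 3),
        f ((quasiSplit F E c 3).toAdelic (weylLongU (c : E →+* E) (rfl : (StdForm.antidiagonal 3).over E = (StdForm.antidiagonal 3).over E)) *
          (v : (quasiSplit F E c 3).Adelic) * g) ∂ν) x := by
  intro u hu x
  simp only [integral_weyl_mul_unipotent_mul_three hc ν f hu x]

/-- **THE `hMf` BINDER OF R6b∕R6c DISCHARGED ON `U(J₃)`** (Track-A spelling): `M f (β x) = M f (x)` for `β ∈ arithmeticBorel = B(F)`, `f` Borel-measurable and left-`B(F)`-invariant.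
[cite: MoeglinWaldspurger1995, II.1.7] [cite: Garrett2018, §2.8] -/
theorem intertwinedSection_arithmeticBorel_mul_three (hc : c * c = 1) (hc1 : c ≠ 1) (ν : Measure ↥(adelicUnipotent F E c 3)) [ν.IsHaarMeasure]
    (𝓕 : Set ↥(adelicUnipotent F E c 3)) {f : (quasiSplit F E c 3).Adelic → ℂ} (hfm : Measurable f)
    (hf : ∀ b ∈ arithmeticBorel F E c 3, ∀ x : (quasiSplit F E c 3).Adelic, f ((b : (quasiSplit F E c 3).Adelic) * x) = f x) :
    ∀ b ∈ arithmeticBorel F E c 3, ∀ x : (quasiSplit F E c 3).Adelic,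
      (fun g : (quasiSplit F E c 3).Adelic => ((ν 𝓕).toReal⁻¹ : ℝ) • ∫ v : ↥(adelicUnipotent F E c 3),
        f ((quasiSplit F E c 3).toAdelic (weylLongU (c : E →+* E) (rfl : (StdForm.antidiagonal 3).over E = (StdForm.antidiagonal 3).over E)) *
          (v : (quasiSplit F E c 3).Adelic) * g) ∂ν) ((b : (quasiSplit F E c 3).Adelic) * x) =
      (fun g : (quasiSplit F E c 3).Adelic => ((ν 𝓕).toReal⁻¹ : ℝ) • ∫ v : ↥(adelicUnipotent F E c 3),
        f ((quasiSplit F E c 3).toAdelic (weylLongU (c : E →+* E) (rfl : (StdForm.antidiagonal 3).over E = (StdForm.antidiagonal 3).over E)) *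
          (v : (quasiSplit F E c 3).Adelic) * g) ∂ν) x := by
  intro b hb x
  obtain ⟨b₀, hb₀⟩ := MonoidHom.mem_range.1 b.2
  have hb₀B := (mem_arithmeticBorel_iff_of_toAdelic_eq hb₀).1 hb
  simp only [← hb₀, integral_weyl_mul_toAdelic_borelU_mul_three hc hc1 ν hfm (forall_arithmeticBorel_iff.1 hf) hb₀B x]

end Three

/-! ## §3 Mok's `U(J₂)`: the twins -/

section Two

variable {F E : Type} [Field F] [NumberField F] [Field E] [NumberField E] [Algebra F E] {c : E ≃ₐ[F] E}
  [MeasurableSpace (quasiSplit F E c 2).Adelic] [BorelSpace (quasiSplit F E c 2).Adelic]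

/-- `∫ f(ι(J₂) v (u g)) dν = ∫ f(ι(J₂) v g) dν` for `u ∈ N(𝔸_F)` (`U(J₂)`: `N(𝔸_F)` is abelian, ★ `isMulRightInvariant_of_isMulLeftInvariant_two`). [cite: MoeglinWaldspurger1995, II.1.6] -/
theorem integral_weyl_mul_unipotent_mul_two (ν : Measure ↥(adelicUnipotent F E c 2)) [ν.IsMulLeftInvariant] (f : (quasiSplit F E c 2).Adelic → ℂ)
    {u : (quasiSplit F E c 2).Adelic} (hu : u ∈ adelicUnipotent F E c 2) (g : (quasiSplit F E c 2).Adelic) :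
    ∫ v : ↥(adelicUnipotent F E c 2), f ((quasiSplit F E c 2).toAdelic (weylLongU (c : E →+* E) (rfl : (StdForm.antidiagonal 2).over E = (StdForm.antidiagonal 2).over E)) *
        (v : (quasiSplit F E c 2).Adelic) * (u * g)) ∂ν =
      ∫ v : ↥(adelicUnipotent F E c 2), f ((quasiSplit F E c 2).toAdelic (weylLongU (c : E →+* E) (rfl : (StdForm.antidiagonal 2).over E = (StdForm.antidiagonal 2).over E)) *
        (v : (quasiSplit F E c 2).Adelic) * g) ∂ν := by
  haveI := isMulRightInvariant_of_isMulLeftInvariant_two (F := F) (E := E) (c := c) ν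
  exact integral_weyl_mul_unipotent_mul (adelicUnipotent F E c 2) ν f _ ⟨u, hu⟩ g

/-- `(v ↦ ι t₀⁻¹ v ι t₀)_* ν = ν` for a rational Borel `b₀ ∈ B(F)` of `U(J₂)` (★ `map_borelConj_eq_torusRootModulus_smul_two` + product formula). [cite: MoeglinWaldspurger1995, I.2.6] -/
theorem map_conj_toAdelic_eq_self_two (hc : c * c = 1) (hc1 : c ≠ 1) (ν : Measure ↥(adelicUnipotent F E c 2)) [ν.IsHaarMeasure]
    {b₀ : ↥(unitaryGroupOfForm (c : E →+* E) ((StdForm.antidiagonal 2).over E))} (hb₀ : b₀ ∈ borelU (c : E →+* E) ((StdForm.antidiagonal 2).over E)) :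
    ν.map (fun v : ↥(adelicUnipotent F E c 2) => (⟨((quasiSplit F E c 2).toAdelic b₀)⁻¹ * (v : (quasiSplit F E c 2).Adelic) * (quasiSplit F E c 2).toAdelic b₀,
      conj_mem_adelicUnipotent ((K2E1PseudoEisensteinConstantTermU.toAdelic_mem_borelAdelic_iff b₀).2 hb₀) v.2⟩ : ↥(adelicUnipotent F E c 2))) = ν := by
  haveI : LocallyCompactSpace (AdeleRing (𝓞 E) E) := locallyCompactSpace_adeleRing' E
  letI : MeasurableSpace (AdeleRing (𝓞 E) E) := borel _
  haveI : BorelSpace (AdeleRing (𝓞 E) E) := ⟨rfl⟩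
  have hB : (quasiSplit F E c 2).toAdelic b₀ ∈ borelAdelic F E c 2 := (K2E1PseudoEisensteinConstantTermU.toAdelic_mem_borelAdelic_iff b₀).2 hb₀
  have h := map_borelConj_eq_torusRootModulus_smul_two hc hc1 ν ⟨(quasiSplit F E c 2).toAdelic b₀, hB⟩
  have h1 : torusRootModulus E 2 (diagUnit (⟨(quasiSplit F E c 2).toAdelic b₀, hB⟩ : borelAdelic F E c 2).2) = 1 :=
    torusRootModulus_diagUnit_eq_one_of_mem_arithmeticSubgroup _ ⟨b₀, rfl⟩
  rw [h1, ENNReal.coe_one, one_smul] at h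
  exact h

/-- **`∫ f(ι(J₂) v (ι b₀ g)) dν = ∫ f(ι(J₂) v g) dν` for every rational Borel `b₀ ∈ B(F)` of `U(J₂)`.** [cite: MoeglinWaldspurger1995, II.1.7] [cite: Garrett2018, §2.8] -/
theorem integral_weyl_mul_toAdelic_borelU_mul_two (hc : c * c = 1) (hc1 : c ≠ 1) (ν : Measure ↥(adelicUnipotent F E c 2)) [ν.IsHaarMeasure]
    {f : (quasiSplit F E c 2).Adelic → ℂ} (hfm : Measurable f)
    (hf : ∀ b ∈ borelU (c : E →+* E) ((StdForm.antidiagonal 2).over E), ∀ x : (quasiSplit F E c 2).Adelic, f ((quasiSplit F E c 2).toAdelic b * x) = f x)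
    {b₀ : ↥(unitaryGroupOfForm (c : E →+* E) ((StdForm.antidiagonal 2).over E))} (hb₀ : b₀ ∈ borelU (c : E →+* E) ((StdForm.antidiagonal 2).over E))
    (g : (quasiSplit F E c 2).Adelic) :
    ∫ v : ↥(adelicUnipotent F E c 2), f ((quasiSplit F E c 2).toAdelic (weylLongU (c : E →+* E) (rfl : (StdForm.antidiagonal 2).over E = (StdForm.antidiagonal 2).over E)) *
        (v : (quasiSplit F E c 2).Adelic) * ((quasiSplit F E c 2).toAdelic b₀ * g)) ∂ν =
      ∫ v : ↥(adelicUnipotent F E c 2), f ((quasiSplit F E c 2).toAdelic (weylLongU (c : E →+* E) (rfl : (StdForm.antidiagonal 2).over E = (StdForm.antidiagonal 2).over E)) *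
        (v : (quasiSplit F E c 2).Adelic) * g) ∂ν := by
  set t₀ : ↥(torusU (c : E →+* E) ((StdForm.antidiagonal 2).over E)) :=
    (borelTriple (c : E →+* E) ((StdForm.antidiagonal 2).over E) rfl).proj ⟨b₀, hb₀⟩ with ht₀
  have hn₀ : (t₀ : ↥(unitaryGroupOfForm (c : E →+* E) ((StdForm.antidiagonal 2).over E)))⁻¹ * b₀ ∈ unipotentU (c : E →+* E) ((StdForm.antidiagonal 2).over E) :=
    (borelTriple (c : E →+* E) ((StdForm.antidiagonal 2).over E) rfl).proj_inv_mul_mem ⟨b₀, hb₀⟩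
  have ht₀B : (t₀ : ↥(unitaryGroupOfForm (c : E →+* E) ((StdForm.antidiagonal 2).over E))) ∈ borelU (c : E →+* E) ((StdForm.antidiagonal 2).over E) :=
    torusU_le_borelU _ _ t₀.2
  have hdec : (quasiSplit F E c 2).toAdelic b₀ = (quasiSplit F E c 2).toAdelic (t₀ : ↥(unitaryGroupOfForm (c : E →+* E) ((StdForm.antidiagonal 2).over E))) *
      (quasiSplit F E c 2).toAdelic ((t₀ : ↥(unitaryGroupOfForm (c : E →+* E) ((StdForm.antidiagonal 2).over E)))⁻¹ * b₀) := by
    rw [← toAdelic_mul_quasiSplit, mul_inv_cancel_left]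
  have hn₀A : (quasiSplit F E c 2).toAdelic ((t₀ : ↥(unitaryGroupOfForm (c : E →+* E) ((StdForm.antidiagonal 2).over E)))⁻¹ * b₀) ∈ adelicUnipotent F E c 2 :=
    (toAdelic_mem_adelicUnipotent_iff _).2 hn₀
  have hwt : ∀ y : (quasiSplit F E c 2).Adelic,
      f ((quasiSplit F E c 2).toAdelic (weylLongU (c : E →+* E) (rfl : (StdForm.antidiagonal 2).over E = (StdForm.antidiagonal 2).over E)) *
        (quasiSplit F E c 2).toAdelic (t₀ : ↥(unitaryGroupOfForm (c : E →+* E) ((StdForm.antidiagonal 2).over E))) *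
        ((quasiSplit F E c 2).toAdelic (weylLongU (c : E →+* E) (rfl : (StdForm.antidiagonal 2).over E = (StdForm.antidiagonal 2).over E)))⁻¹ * y) = f y := fun y => by
    rw [← map_inv, ← toAdelic_mul_quasiSplit, ← toAdelic_mul_quasiSplit]
    exact hf _ (weylConj_mem_two (c : E →+* E) rfl (weylLongU (c : E →+* E) rfl) (coe_coe_weylLongU (c : E →+* E) rfl) t₀).2 y
  haveI : ν.IsMulLeftInvariant := inferInstance
  rw [hdec, mul_assoc ((quasiSplit F E c 2).toAdelic (t₀ : ↥(unitaryGroupOfForm (c : E →+* E) ((StdForm.antidiagonal 2).over E)))),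
    integral_weyl_mul_conj_mul (adelicUnipotent F E c 2) ν hfm _ (fun v => conj_mem_adelicUnipotent ((K2E1PseudoEisensteinConstantTermU.toAdelic_mem_borelAdelic_iff _).2 ht₀B) v.2)
      (map_conj_toAdelic_eq_self_two hc hc1 ν ht₀B) hwt,
    integral_weyl_mul_unipotent_mul_two ν f hn₀A g]

/-- The `hMfN` binder on `U(J₂)`. [cite: MoeglinWaldspurger1995, II.1.7] -/
theorem intertwinedSection_unipotent_mul_two (ν : Measure ↥(adelicUnipotent F E c 2)) [ν.IsMulLeftInvariant] (𝓕 : Set ↥(adelicUnipotent F E c 2))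
    (f : (quasiSplit F E c 2).Adelic → ℂ) :
    ∀ u ∈ adelicUnipotent F E c 2, ∀ x : (quasiSplit F E c 2).Adelic,
      (fun g : (quasiSplit F E c 2).Adelic => ((ν 𝓕).toReal⁻¹ : ℝ) • ∫ v : ↥(adelicUnipotent F E c 2),
        f ((quasiSplit F E c 2).toAdelic (weylLongU (c : E →+* E) (rfl : (StdForm.antidiagonal 2).over E = (StdForm.antidiagonal 2).over E)) *
          (v : (quasiSplit F E c 2).Adelic) * g) ∂ν) (u * x) =
      (fun g : (quasiSplit F E c 2).Adelic => ((ν 𝓕).toReal⁻¹ : ℝ) • ∫ v : ↥(adelicUnipotent F E c 2),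
        f ((quasiSplit F E c 2).toAdelic (weylLongU (c : E →+* E) (rfl : (StdForm.antidiagonal 2).over E = (StdForm.antidiagonal 2).over E)) *
          (v : (quasiSplit F E c 2).Adelic) * g) ∂ν) x := by
  intro u hu x
  simp only [integral_weyl_mul_unipotent_mul_two ν f hu x]

/-- The `hMf` binder on `U(J₂)` (Track-A spelling). [cite: MoeglinWaldspurger1995, II.1.7] [cite: Garrett2018, §2.8] -/
theorem intertwinedSection_arithmeticBorel_mul_two (hc : c * c = 1) (hc1 : c ≠ 1) (ν : Measure ↥(adelicUnipotent F E c 2)) [ν.IsHaarMeasure]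
    (𝓕 : Set ↥(adelicUnipotent F E c 2)) {f : (quasiSplit F E c 2).Adelic → ℂ} (hfm : Measurable f)
    (hf : ∀ b ∈ arithmeticBorel F E c 2, ∀ x : (quasiSplit F E c 2).Adelic, f ((b : (quasiSplit F E c 2).Adelic) * x) = f x) :
    ∀ b ∈ arithmeticBorel F E c 2, ∀ x : (quasiSplit F E c 2).Adelic,
      (fun g : (quasiSplit F E c 2).Adelic => ((ν 𝓕).toReal⁻¹ : ℝ) • ∫ v : ↥(adelicUnipotent F E c 2),
        f ((quasiSplit F E c 2).toAdelic (weylLongU (c : E →+* E) (rfl : (StdForm.antidiagonal 2).over E = (StdForm.antidiagonal 2).over E)) *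
          (v : (quasiSplit F E c 2).Adelic) * g) ∂ν) ((b : (quasiSplit F E c 2).Adelic) * x) =
      (fun g : (quasiSplit F E c 2).Adelic => ((ν 𝓕).toReal⁻¹ : ℝ) • ∫ v : ↥(adelicUnipotent F E c 2),
        f ((quasiSplit F E c 2).toAdelic (weylLongU (c : E →+* E) (rfl : (StdForm.antidiagonal 2).over E = (StdForm.antidiagonal 2).over E)) *
          (v : (quasiSplit F E c 2).Adelic) * g) ∂ν) x := by
  intro b hb x
  obtain ⟨b₀, hb₀⟩ := MonoidHom.mem_range.1 b.2
  have hb₀B := (mem_arithmeticBorel_iff_of_toAdelic_eq hb₀).1 hb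
  simp only [← hb₀, integral_weyl_mul_toAdelic_borelU_mul_two hc hc1 ν hfm (forall_arithmeticBorel_iff.1 hf) hb₀B x]

end Two

end Summit.HodgeConjecture.HodgeConjecture.Cruxes.H413.K2E1IntertwinedSectionInvariance

end
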